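import Mathlib
import Summits.NavierStokesRegularity.NavierStokesRegularity.Theorems.TaoLadderRungThreeGappedFrontRobustTailStep
import Summits.NavierStokesRegularity.NavierStokesRegularity.Theorems.TaoLadderRungThreeGappedFrontRobustStepTransfer
import Summits.NavierStokesRegularity.NavierStokesRegularity.Theorems.TaoLadderRungThreeGappedFrontRobustTailStart
import Summits.NavierStokesRegularity.NavierStokesRegularity.Theorems.TaoLadderRungThreeGappedFrontRobustSelection
import HarnessLib

/-!
# `TrappingWindowRungThree.TailEnvelopes` (item stmt-NavierStokesRegularity-21748, crux K2) — the AHEAD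
  tail: the per-shell energy envelope `5 · Cg · 2^{-7k}` reproduces itself

Route `TrappingWindowRungThree` (rung TL-M3 of the Tao ladder; MODEL lattice ODEs only). Along an
`(η, η)`-pseudo-flow at scale ratio `2` (Tao 2016, §4 (4.5), (4.9)–(4.10) with the cancellation (4.3),
cell vocabulary `TaoCascade.PseudoFlowOn`) whose start energies ahead of the window obey
`F₀_{i,k} ≤ Cg 2^{-7k}` (`k > Ka`) and whose top window shell stays under the sup bound `|S_{i,Ka}| ≤ M_{Ka}`
on `[0, σ]` (`σ ≤ c`), the parameter conditions PC2 (`2560 c M_{Ka}² 2^{6Ka} ≤ √Cg`) and PC3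
(`51200 c √Cg ≤ 2^{Ka+2}`) force `∑_i F_{i,k}(s) ≤ (99/20) · Cg 2^{-7k} < 5 · Cg 2^{-7k}` for every
`k > Ka` and `s ∈ [0, σ]` (`ahead_tail_envelope`).

PROOF. Energy enters the shells `≥ K` only through the bond `K-1 | K` (`pseudoFlowOn_shell_energy_le_tail`,
start budget `E₀(K) = (512/127) Cg 2^{-7K}`). BOOTSTRAP on `∑_i F_{i,k} ≤ 5 Cg 2^{-7k}` (`k > Ka`): the flux
through `Ka | Ka+1` is `≤ 64·2^{5Ka/2} M_{Ka}² √(10 Cg 2^{-7(Ka+1)})` (`abs_botSum_le_of_abs_le`, budget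
`(9/10) Cg 2^{-7(Ka+1)}` over the clock by PC2), through `K-1 | K` with `K ≥ Ka+2` it is
`≤ 128·2^{5(K-1)/2} √(10 Cg 2^{-7K})·5 Cg 2^{-7(K-1)}` (`abs_botSum_le_energy`, budget by PC3); so the bound
improves to `(512/127 + 9/10) < 99/20 < 5`, and real induction over `[0, σ]` closes the bootstrap (only
finitely many shells are not already settled by the a priori decay (4.5)).

HONEST FRAMING: bookkeeping about Tao-type MODEL lattice pseudo-flows; nothing here is a statement about
the Navier–Stokes equations; NS regularity is NOT proved by anything in this file.
-/

noncomputable section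

-- the sub-problem namespace repeats the summit name by design (D-0017)
set_option linter.dupNamespace false

namespace Summit.NavierStokesRegularity.NavierStokesRegularity.Theorems

open Set Filter Topology MeasureTheory intervalIntegral Literature.Analysis.FluidPDE
  Literature.Analysis.FluidPDE.TaoCascade GappedFrontRobust

namespace TailEnvelopes

/-! ### Numeric budgets of the two flux estimates -/

/-- `a √b ≤ d` from `a² b ≤ d²` (`a, d ≥ 0`). [folklore] -/
theorem mul_sqrt_le_of_sq_mul_le {a b d : ℝ} (ha : 0 ≤ a) (hd : 0 ≤ d) (h : a ^ 2 * b ≤ d ^ 2) :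
    a * Real.sqrt b ≤ d := by
  rcases lt_or_ge b 0 with hb | hb
  · rw [Real.sqrt_eq_zero'.mpr hb.le, mul_zero]; exact hd
  · calc a * Real.sqrt b = Real.sqrt (a ^ 2 * b) := by
          rw [Real.sqrt_mul (sq_nonneg a), Real.sqrt_sq ha]
      _ ≤ Real.sqrt (d ^ 2) := Real.sqrt_le_sqrt h
      _ = d := Real.sqrt_sq hd

/-- `(2^e)² = 2^{2e}`. [folklore] -/
theorem two_rpow_sq (e : ℝ) : ((2 : ℝ) ^ e) ^ 2 = (2 : ℝ) ^ (2 * e) := by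
  rw [← Real.rpow_natCast, ← Real.rpow_mul zero_le_two]; ring_nf

/-- **Flux budget at the top window bond (PC2).** With `x = Ka`: if `2560 c M² 2^{6x} ≤ √Cg` (`c ≥ 0`,
`Cg > 0`) then `64 c 2^{5x/2} M² √(10 · Cg 2^{-7(x+1)}) ≤ (9/10) · Cg 2^{-7(x+1)}`
(squared: `2^{12x} · 2^{-7(x+1)} = 2^{5x}/128` and `5242880 ≤ 0.81 · 6553600`). [folklore] -/
theorem flux_budget_top {c M Cg x : ℝ} (hc : 0 ≤ c) (hCg : 0 < Cg)
    (hPC2 : 2560 * c * M ^ 2 * (2 : ℝ) ^ (6 * x) ≤ Real.sqrt Cg) :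
    64 * c * (2 : ℝ) ^ ((5 : ℝ) * x / 2) * M ^ 2 * Real.sqrt (10 * (Cg * (2 : ℝ) ^ (-(7 : ℝ) * (x + 1)))) ≤
      9 / 10 * (Cg * (2 : ℝ) ^ (-(7 : ℝ) * (x + 1))) := by
  set p : ℝ := (2 : ℝ) ^ ((5 : ℝ) * x / 2) with hp
  set S6 : ℝ := (2 : ℝ) ^ (6 * x) with hS6
  set E : ℝ := (2 : ℝ) ^ (-(7 : ℝ) * (x + 1)) with hE
  have hE0 : 0 < E := Real.rpow_pos_of_pos two_pos _
  have hL0 : 0 ≤ 2560 * c * M ^ 2 * S6 := by positivity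
  have hPC2' : (2560 * c * M ^ 2 * S6) ^ 2 ≤ Cg := by
    have h1 := pow_le_pow_left₀ hL0 hPC2 2
    rwa [Real.sq_sqrt hCg.le] at h1
  -- the exponent identity p² = 128 · S6² · E
  have hid : p ^ 2 = 128 * (S6 ^ 2 * E) := by
    rw [hp, hS6, hE, two_rpow_sq, two_rpow_sq, ← Real.rpow_add two_pos]
    have h128 : (128 : ℝ) = (2 : ℝ) ^ (7 : ℝ) := by
      rw [show (7 : ℝ) = ((7 : ℕ) : ℝ) by norm_num, Real.rpow_natCast]; norm_num
    rw [h128, ← Real.rpow_add two_pos]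
    ring_nf
  refine mul_sqrt_le_of_sq_mul_le (by positivity) (by positivity) ?_
  -- a² b ≤ d²
  have e1 : (64 * c * p * M ^ 2) ^ 2 * (10 * (Cg * E)) =
      5242880 * (2560 * c * M ^ 2 * S6) ^ 2 / 6553600 * (Cg * E ^ 2) := by
    rw [mul_pow, mul_pow, mul_pow, hid]; ring
  rw [e1]
  have h2 : 5242880 * (2560 * c * M ^ 2 * S6) ^ 2 / 6553600 * (Cg * E ^ 2) ≤
      5242880 * Cg / 6553600 * (Cg * E ^ 2) :=
    mul_le_mul_of_nonneg_right (by gcongr) (by positivity)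
  have h3 : 0 ≤ Cg * (Cg * E ^ 2) := by positivity
  nlinarith

/-- **Flux budget at the bonds ahead (PC3).** With `x = Ka`, `y = K ≥ x + 2`: if `51200 c √Cg ≤ 2^{x+2}`
(`c ≥ 0`, `Cg > 0`) then
`c (2 · 2^{5(y-1)/2} √(10 · Cg 2^{-7y}) · 64 · (5 · Cg 2^{-7(y-1)})) ≤ (9/10) · Cg 2^{-7y}`
(squared: `c² Cg ≤ 2^{2x+4}/51200²`, `2^{5(y-1)} 2^{-7y} = 2^{-2y-5}`, `25.6 · 2^{2(x-y)-1} ≤ 0.8`). [folklore] -/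
theorem flux_budget_ahead {c Cg x y : ℝ} (hc : 0 ≤ c) (hCg : 0 < Cg)
    (hPC3 : 51200 * c * Real.sqrt Cg ≤ (2 : ℝ) ^ (x + 2)) (hy : x + 2 ≤ y) :
    c * (2 * (2 : ℝ) ^ ((5 : ℝ) * (y - 1) / 2) * Real.sqrt (10 * (Cg * (2 : ℝ) ^ (-(7 : ℝ) * y))) * 64 *
        (5 * (Cg * (2 : ℝ) ^ (-(7 : ℝ) * (y - 1))))) ≤
      9 / 10 * (Cg * (2 : ℝ) ^ (-(7 : ℝ) * y)) := by
  set p : ℝ := (2 : ℝ) ^ ((5 : ℝ) * (y - 1) / 2) with hp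
  set E : ℝ := (2 : ℝ) ^ (-(7 : ℝ) * y) with hE
  set E' : ℝ := (2 : ℝ) ^ (-(7 : ℝ) * (y - 1)) with hE'
  set G : ℝ := (2 : ℝ) ^ (x + 2) with hG
  have hp0 : 0 < p := Real.rpow_pos_of_pos two_pos _
  have hE0 : 0 < E := Real.rpow_pos_of_pos two_pos _
  have hE'0 : 0 < E' := Real.rpow_pos_of_pos two_pos _
  have hL0 : 0 ≤ 51200 * c * Real.sqrt Cg := by positivity
  have hPC3' : (51200 * c) ^ 2 * Cg ≤ G ^ 2 := by
    have h1 := pow_le_pow_left₀ hL0 hPC3 2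
    rwa [mul_pow, Real.sq_sqrt hCg.le] at h1
  -- exponent identities: E' = 128 E, p² E = 2^{-2y-5}, G² 2^{-2y-5} ≤ 1/32
  have hE'E : E' = 128 * E := by
    rw [hE', hE]
    have h128 : (128 : ℝ) = (2 : ℝ) ^ (7 : ℝ) := by
      rw [show (7 : ℝ) = ((7 : ℕ) : ℝ) by norm_num, Real.rpow_natCast]; norm_num
    rw [h128, ← Real.rpow_add two_pos]; ring_nf
  have hpE : p ^ 2 * E = (2 : ℝ) ^ (-2 * y - 5) := by
    rw [hp, hE, two_rpow_sq, ← Real.rpow_add two_pos]; ring_nf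
  have hGH : G ^ 2 * (2 : ℝ) ^ (-2 * y - 5) ≤ 1 / 32 := by
    rw [hG, two_rpow_sq, ← Real.rpow_add two_pos]
    calc (2 : ℝ) ^ (2 * (x + 2) + (-2 * y - 5)) ≤ (2 : ℝ) ^ (-(5 : ℝ)) :=
          Real.rpow_le_rpow_of_exponent_le one_le_two (by linarith)
      _ = 1 / 32 := by
          rw [Real.rpow_neg zero_le_two, show (5 : ℝ) = ((5 : ℕ) : ℝ) by norm_num, Real.rpow_natCast]
          norm_num
  have hH0 : 0 ≤ (2 : ℝ) ^ (-2 * y - 5) := Real.rpow_nonneg zero_le_two _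
  -- rearrange to a √b ≤ d
  have e0 : c * (2 * p * Real.sqrt (10 * (Cg * E)) * 64 * (5 * (Cg * E'))) =
      (640 * c * p * (Cg * E')) * Real.sqrt (10 * (Cg * E)) := by ring
  rw [e0]
  refine mul_sqrt_le_of_sq_mul_le (by positivity) (by positivity) ?_
  rw [hE'E]
  -- a² b = 81920² · 10 · (c² Cg) · (p² E) · Cg² E²
  have e1 : (640 * c * p * (Cg * (128 * E))) ^ 2 * (10 * (Cg * E)) =
      67108864000 * ((c ^ 2 * Cg) * (p ^ 2 * E)) * (Cg ^ 2 * E ^ 2) := by ring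
  rw [e1, hpE]
  have h1 : (c ^ 2 * Cg) * (2 : ℝ) ^ (-2 * y - 5) * 2621440000 ≤ G ^ 2 * (2 : ℝ) ^ (-2 * y - 5) := by
    have := mul_le_mul_of_nonneg_right hPC3' hH0
    nlinarith
  have h2 : 0 ≤ Cg ^ 2 * E ^ 2 := by positivity
  have h3 : 67108864000 * ((c ^ 2 * Cg) * (2 : ℝ) ^ (-2 * y - 5)) ≤ 4 / 5 := by nlinarith
  have h4 := mul_le_mul_of_nonneg_right h3 h2
  nlinarith

/-- On Tao's four modes the `(0,0,1)`-constants of a table with `|α| ≤ 1` on the shift set have total size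
`≤ 64`. [cite: Tao2016AveragedNS, §4 (4.1)–(4.2)] -/
theorem sum_abs_coeff_001_le {α : Fin 4 → Fin 4 → Fin 4 → ℤ × ℤ × ℤ → ℝ}
    (hα : ∀ (i₁ i₂ i₃ : Fin 4) (μ : ℤ × ℤ × ℤ), μ ∈ shiftSet → |α i₁ i₂ i₃ μ| ≤ 1) :
    ∑ i₁, ∑ i₂, ∑ i₃, |α i₁ i₂ i₃ (0, 0, 1)| ≤ 64 := by
  have h001 : ((0 : ℤ), (0 : ℤ), (1 : ℤ)) ∈ shiftSet := by simp [shiftSet]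
  calc ∑ i₁, ∑ i₂, ∑ i₃, |α i₁ i₂ i₃ (0, 0, 1)| ≤ ∑ _i₁ : Fin 4, ∑ _i₂ : Fin 4, ∑ _i₃ : Fin 4, (1 : ℝ) :=
        Finset.sum_le_sum fun i₁ _ => Finset.sum_le_sum fun i₂ _ => Finset.sum_le_sum fun i₃ _ =>
          hα i₁ i₂ i₃ _ h001
    _ = 64 := by simp; norm_num


/-! ### The ahead tail envelope -/

variable {σ η : ℝ} {α : Fin 4 → Fin 4 → Fin 4 → ℤ × ℤ × ℤ → ℝ}
  {S₀ F₀ B₀ : Fin 4 → ℤ → ℝ} {S F : Fin 4 → ℤ → ℝ → ℝ}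

/-- **The ahead tail envelope reproduces itself with margin.** Along an `(η, η)`-pseudo-flow at scale
ratio `2` on `[0, σ]` (`0 < σ ≤ c`) for a cancelling table with `|α| ≤ 1` on the shift set, if the start
energies ahead of the window obey `F₀_{i,k} ≤ Cg 2^{-7k}` (`k > Ka`), the top window shell stays under
`|S_{i,Ka}| ≤ M_{Ka}` on `[0, σ]`, and PC2, PC3 hold, then `∑_i F_{i,k}(s) ≤ (99/20) Cg 2^{-7k}` for every
`k > Ka` and `s ∈ [0, σ]` (see the module docstring for the proof).
[cite: Tao2016AveragedNS, §4 Lemma 4.1 (4.5), (4.9)–(4.10) with (4.3)] -/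
theorem ahead_tail_envelope (h : PseudoFlowOn σ 1 α η η S₀ F₀ B₀ S F) (hσ : 0 < σ)
    {c Cg MKa : ℝ} {Ka : ℤ} (hσc : σ ≤ c) (hαc : IsCancellingCoeff α)
    (hα1 : ∀ (i₁ i₂ i₃ : Fin 4) (μ : ℤ × ℤ × ℤ), μ ∈ shiftSet → |α i₁ i₂ i₃ μ| ≤ 1)
    (hCg : 0 < Cg) (hPC2 : 2560 * c * MKa ^ 2 * (2 : ℝ) ^ (6 * (Ka : ℝ)) ≤ Real.sqrt Cg)
    (hPC3 : 51200 * c * Real.sqrt Cg ≤ (2 : ℝ) ^ ((Ka : ℝ) + 2))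
    (hF₀ : ∀ i k, Ka < k → F₀ i k ≤ Cg * (2 : ℝ) ^ (-(7 : ℝ) * (k : ℝ)))
    (hwin : ∀ i, ∀ s ∈ Icc 0 σ, |S i Ka s| ≤ MKa) :
    ∀ k, Ka < k → ∀ s ∈ Icc 0 σ, ∑ i, F i k s ≤ 99 / 20 * (Cg * (2 : ℝ) ^ (-(7 : ℝ) * (k : ℝ))) := by
  have h2 : (1 + 1 : ℝ) = 2 := one_add_one_eq_two
  have hc : 0 < c := hσ.trans_le hσc
  set env : ℤ → ℝ := fun k => Cg * (2 : ℝ) ^ (-(7 : ℝ) * (k : ℝ)) with henv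
  have henv_pos : ∀ k, 0 < env k := fun k => mul_pos hCg (Real.rpow_pos_of_pos two_pos _)
  have henv_succ : ∀ k : ℤ, env k = 128 * env (k + 1) := by
    intro k
    simp only [henv]
    have h128 : (128 : ℝ) = (2 : ℝ) ^ (7 : ℝ) := by
      rw [show (7 : ℝ) = ((7 : ℕ) : ℝ) by norm_num, Real.rpow_natCast]; norm_num
    rw [h128, mul_left_comm, ← Real.rpow_add two_pos]
    push_cast; ring_nf
  have hC64 := sum_abs_coeff_001_le hα1
  have hFcont : ∀ i k, ContinuousOn (F i k) (Icc 0 σ) := fun i k => (h.contDiffOn_F i k).continuousOn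
  have hsumcont : ∀ k, ContinuousOn (fun s => ∑ i, F i k s) (Icc 0 σ) := fun k =>
    continuousOn_finsetSum _ fun i _ => hFcont i k
  -- the start energies, summed over modes
  have hF₀sum : ∀ k, Ka < k → ∑ i, F₀ i k ≤ 4 * env k := by
    intro k hk
    calc ∑ i, F₀ i k ≤ ∑ _i : Fin 4, env k := Finset.sum_le_sum fun i _ => hF₀ i k hk
      _ = 4 * env k := by simp
  -- the start budget above a shell K > Ka
  have hE₀ : ∀ K, Ka < K → ∀ L : ℕ, ∑ j ∈ Finset.range L, ∑ i, F₀ i (K + j) ≤ 512 / 127 * env K := by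
    intro K hK L
    have hg0 : ∀ j : ℕ, 0 ≤ 4 * env (K + j) := fun j => by have := henv_pos (K + j); positivity
    have hstep : ∀ j : ℕ, 4 * env (K + j + 1) ≤ 1 / 128 * (4 * env (K + j)) := fun j => by
      rw [henv_succ (K + j)]; linarith
    have hgeom := geom_partial_sum_le (g := fun k => 4 * env k) (K := K) (by norm_num) (by norm_num)
      hg0 hstep L
    calc ∑ j ∈ Finset.range L, ∑ i, F₀ i (K + j) ≤ ∑ j ∈ Finset.range L, 4 * env (K + j) :=
          Finset.sum_le_sum fun j _ => hF₀sum (K + j) (by have := Int.natCast_nonneg j; linarith)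
      _ ≤ 4 * env K / (1 - 1 / 128) := hgeom
      _ = 512 / 127 * env K := by ring
  -- IMPROVE: the bootstrap bound `≤ 5 env` on [0, t] improves to `≤ 99/20 env` on [0, t]
  have improve : ∀ t ∈ Icc 0 σ, 0 < t →
      (∀ k, Ka < k → ∀ u ∈ Icc 0 t, ∑ i, F i k u ≤ 5 * env k) →
      ∀ K, Ka < K → ∀ u ∈ Icc 0 t, ∑ i, F i K u ≤ 99 / 20 * env K := by
    intro t ht htpos hyp K hK u hu
    have ht' : PseudoFlowOn t 1 α η η S₀ F₀ B₀ S F := pseudoFlowOn_mono h htpos ht.2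
    have htc : t ≤ c := ht.2.trans hσc
    -- amplitudes ahead on [0, t]
    have hQ : ∀ k, Ka < k → ∀ v ∈ Icc 0 t, ∀ i, |S i k v| ≤ Real.sqrt (10 * env k) := by
      intro k hk v hv i
      have hvσ : v ∈ Icc 0 σ := ⟨hv.1, hv.2.trans ht.2⟩
      have hFi : F i k v ≤ ∑ j, F j k v :=
        Finset.single_le_sum (f := fun j => F j k v) (fun j _ => h.nonneg_F j k v hvσ) (Finset.mem_univ i)
      have h5 := hyp k hk v hv
      have hlow := h.defect_lower i k v hvσ
      refine Real.abs_le_sqrt ?_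
      linarith
    -- the shell energy is fed through the bond K-1 | K
    have hshell := pseudoFlowOn_shell_energy_le_tail ht' htpos one_pos hαc K (hE₀ K hK) le_rfl hu
    -- flux bound through the bond, with its clock budget
    have hflux : ∃ B : ℝ, 0 ≤ B ∧ c * B ≤ 9 / 10 * env K ∧
        ∀ v ∈ Icc 0 t, |botSum 1 α S (K - 1) v| ≤ B := by
      rcases lt_or_eq_of_le (show Ka + 1 ≤ K by omega) with hK2 | hK1
      · -- K ≥ Ka + 2: both factors of the bond flux sit ahead of the window
        refine ⟨2 * (2 : ℝ) ^ ((5 : ℝ) * ((K : ℝ) - 1) / 2) * Real.sqrt (10 * env K) * 64 *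
            (5 * env (K - 1)), by have := henv_pos (K - 1); positivity, ?_, ?_⟩
        · have hb := flux_budget_ahead (x := (Ka : ℝ)) (y := (K : ℝ)) hc.le hCg hPC3
            (by have : ((Ka : ℝ) + 2 : ℝ) ≤ (K : ℝ) := by exact_mod_cast (show Ka + 2 ≤ K by omega)
                linarith)
          have e1 : env (K - 1) = Cg * (2 : ℝ) ^ (-(7 : ℝ) * ((K : ℝ) - 1)) := by
            simp only [henv]; push_cast; ring_nf
          rw [e1]
          exact hb
        · intro v hv
          have hvσ : v ∈ Icc 0 σ := ⟨hv.1, hv.2.trans ht.2⟩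
          have hKm : Ka < K - 1 := by omega
          have hb := abs_botSum_le_energy 1 (by norm_num) α S F (K - 1) v
            (Q := Real.sqrt (10 * env K))
            (fun i => by rw [sub_add_cancel]; exact hQ K hK v hv i)
            (fun i => h.nonneg_F i (K - 1) v hvσ) (fun i => h.defect_lower i (K - 1) v hvσ)
          rw [h2] at hb
          have hcast : ((5 : ℝ) * ((K - 1 : ℤ) : ℝ) / 2) = (5 : ℝ) * ((K : ℝ) - 1) / 2 := by push_cast; ring
          rw [hcast] at hb
          refine hb.trans ?_
          have hE5 := hyp (K - 1) hKm v hv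
          have hpos : 0 ≤ 2 * (2 : ℝ) ^ ((5 : ℝ) * ((K : ℝ) - 1) / 2) * Real.sqrt (10 * env K) := by
            positivity
          have hF0 : 0 ≤ ∑ i, F i (K - 1) v := Finset.sum_nonneg fun i _ => h.nonneg_F i _ v hvσ
          exact mul_le_mul (mul_le_mul_of_nonneg_left hC64 hpos) hE5 hF0 (by positivity)
      · -- K = Ka + 1: the lower factor is the top window shell
        refine ⟨(2 : ℝ) ^ ((5 : ℝ) * (Ka : ℝ) / 2) * MKa ^ 2 * Real.sqrt (10 * env K) * 64,
          by positivity, ?_, ?_⟩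
        · have hb := flux_budget_top (x := (Ka : ℝ)) (M := MKa) hc.le hCg hPC2
          have e1 : env K = Cg * (2 : ℝ) ^ (-(7 : ℝ) * ((Ka : ℝ) + 1)) := by
            simp only [henv, ← hK1]; push_cast; ring_nf
          rw [e1]
          linarith
        · intro v hv
          have hvσ : v ∈ Icc 0 σ := ⟨hv.1, hv.2.trans ht.2⟩
          have hKa : K - 1 = Ka := by omega
          rw [hKa]
          have hMnn : 0 ≤ MKa := (abs_nonneg _).trans (hwin 0 v hvσ)
          have hb := abs_botSum_le_of_abs_le 1 (by norm_num) α S Ka v (P := MKa)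
            (Q := Real.sqrt (10 * env K)) (fun i => hwin i v hvσ)
            (fun i => by rw [hK1]; exact hQ K hK v hv i)
          rw [h2] at hb
          refine hb.trans ?_
          have hpos : 0 ≤ (2 : ℝ) ^ ((5 : ℝ) * (Ka : ℝ) / 2) * MKa ^ 2 * Real.sqrt (10 * env K) := by
            positivity
          exact mul_le_mul_of_nonneg_left hC64 hpos
    obtain ⟨B, hB0, hcB, hBv⟩ := hflux
    -- the time integral of the flux
    have hint : ∫ v in (0 : ℝ)..u, botSum 1 α S (K - 1) v ≤ c * B := by
      have hle : ∀ v ∈ Set.uIoc (0 : ℝ) u, ‖botSum 1 α S (K - 1) v‖ ≤ B := by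
        intro v hv
        rw [uIoc_of_le hu.1] at hv
        rw [Real.norm_eq_abs]
        exact hBv v ⟨hv.1.le, hv.2.trans hu.2⟩
      have h1 := intervalIntegral.norm_integral_le_of_norm_le_const hle
      rw [Real.norm_eq_abs, sub_zero, abs_of_nonneg hu.1] at h1
      have h3 : B * u ≤ B * c := mul_le_mul_of_nonneg_left (hu.2.trans htc) hB0
      linarith [le_abs_self (∫ v in (0 : ℝ)..u, botSum 1 α S (K - 1) v)]
    have := henv_pos K
    linarith
  -- REAL INDUCTION over [0, σ] on the bootstrap set
  set s : Set ℝ := {t | t ∈ Icc (0 : ℝ) σ ∧ ∀ k, Ka < k → ∑ i, F i k t ≤ 5 * env k} with hs_def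
  have hs_sub : s ⊆ Icc 0 σ := fun t ht => ht.1
  have hs_closed : IsClosed (s ∩ Icc 0 σ) := by
    rw [inter_eq_left.mpr hs_sub]
    have hs_eq : s = ⋂ k : ℤ, {t | t ∈ Icc (0 : ℝ) σ ∧ (Ka < k → ∑ i, F i k t ≤ 5 * env k)} := by
      ext t
      simp only [hs_def, mem_setOf_eq, mem_iInter]
      exact ⟨fun ht k => ⟨ht.1, ht.2 k⟩, fun ht => ⟨(ht Ka).1, fun k hk => (ht k).2 hk⟩⟩
    rw [hs_eq]
    refine isClosed_iInter fun k => ?_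
    by_cases hk : Ka < k
    · have hset : {t | t ∈ Icc (0 : ℝ) σ ∧ (Ka < k → ∑ i, F i k t ≤ 5 * env k)} =
          {t ∈ Icc (0 : ℝ) σ | ∑ i, F i k t ≤ 5 * env k} := by
        ext t; simp only [mem_setOf_eq]
        exact ⟨fun ht => ⟨ht.1, ht.2 hk⟩, fun ht => ⟨ht.1, fun _ => ht.2⟩⟩
      rw [hset]
      exact isClosed_Icc.isClosed_le (hsumcont k) continuousOn_const
    · have hset : {t | t ∈ Icc (0 : ℝ) σ ∧ (Ka < k → ∑ i, F i k t ≤ 5 * env k)} = Icc 0 σ := by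
        ext t; simp only [mem_setOf_eq]
        exact ⟨fun ht => ht.1, fun ht => ⟨ht, fun hk' => absurd hk' hk⟩⟩
      rw [hset]
      exact isClosed_Icc
  -- time 0
  have h0bound : ∀ k, Ka < k → ∑ i, F i k 0 ≤ 4 * env k := by
    intro k hk
    have : ∑ i, F i k 0 = ∑ i, F₀ i k := Finset.sum_congr rfl fun i _ => h.init_F i k
    rw [this]; exact hF₀sum k hk
  have h0s : (0 : ℝ) ∈ s := by
    refine ⟨⟨le_rfl, hσ.le⟩, fun k hk => ?_⟩
    have := henv_pos k
    linarith [h0bound k hk]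
  -- far shells are settled by the a priori decay (4.5)
  obtain ⟨Map, hMap0, hMap⟩ := pseudoFlowOn_uniform_bounds h (by norm_num)
  obtain ⟨Kfar, hKfar⟩ := exists_rpow_neg_mul_le_atTop (q := (2 : ℝ)) (s := 13)
    (ε := 5 * Cg / (4 * Map ^ 2 + 1)) one_lt_two (by norm_num) (by positivity)
  have hfar : ∀ k, Kfar ≤ k → ∀ u ∈ Icc 0 σ, ∑ i, F i k u ≤ 5 * env k := by
    intro k hk u hu
    have hq := hKfar k hk
    -- F i k u ≤ Map² 2^{-20k}
    have hFi : ∀ i, F i k u ≤ Map ^ 2 * (2 : ℝ) ^ (-(20 : ℝ) * (k : ℝ)) := by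
      intro i
      have h1 := (hMap u hu i k).2.2.2
      rw [h2] at h1
      have hF0 := h.nonneg_F i k u hu
      have h3 := pow_le_pow_left₀ (Real.sqrt_nonneg _) h1 2
      rw [Real.sq_sqrt hF0, mul_pow, two_rpow_sq] at h3
      have e : (2 : ℝ) * (-(10 : ℝ) * (k : ℝ)) = -(20 : ℝ) * (k : ℝ) := by ring
      rwa [e] at h3
    have hsplit : (2 : ℝ) ^ (-(20 : ℝ) * (k : ℝ)) =
        (2 : ℝ) ^ (-((13 : ℝ) * (k : ℝ))) * (2 : ℝ) ^ (-(7 : ℝ) * (k : ℝ)) := by rw [← Real.rpow_add two_pos]; ring_nf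
    have hq' : (4 * Map ^ 2 + 1) * (2 : ℝ) ^ (-((13 : ℝ) * (k : ℝ))) ≤ 5 * Cg := by
      have := mul_le_mul_of_nonneg_left hq (by positivity : (0 : ℝ) ≤ 4 * Map ^ 2 + 1)
      rwa [mul_div_cancel₀ _ (by positivity : (4 : ℝ) * Map ^ 2 + 1 ≠ 0)] at this
    calc ∑ i, F i k u ≤ ∑ _i : Fin 4, Map ^ 2 * (2 : ℝ) ^ (-(20 : ℝ) * (k : ℝ)) :=
          Finset.sum_le_sum fun i _ => hFi i
      _ = (4 * Map ^ 2 * (2 : ℝ) ^ (-((13 : ℝ) * (k : ℝ)))) * (2 : ℝ) ^ (-(7 : ℝ) * (k : ℝ)) := by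
          rw [Finset.sum_const, Finset.card_univ, Fintype.card_fin, nsmul_eq_mul, hsplit]
          push_cast; ring
      _ ≤ (5 * Cg) * (2 : ℝ) ^ (-(7 : ℝ) * (k : ℝ)) := by
          exact mul_le_mul_of_nonneg_right (by nlinarith) (Real.rpow_nonneg zero_le_two _)
      _ = 5 * env k := by simp only [henv]; ring
  -- the induction
  have hIcc : Icc 0 σ ⊆ s := by
    refine hs_closed.Icc_subset_of_forall_mem_nhdsGT_of_Icc_subset h0s fun t ht hts => ?_
    -- improved bounds at time t
    have hgood : ∀ k, Ka < k → ∑ i, F i k t ≤ 99 / 20 * env k := by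
      rcases ht.1.eq_or_lt with h0 | htpos
      · rw [← h0]
        intro k hk
        have := henv_pos k
        linarith [h0bound k hk]
      · have hyp : ∀ k, Ka < k → ∀ u ∈ Icc 0 t, ∑ i, F i k u ≤ 5 * env k :=
          fun k hk u hu => (hts hu).2 k hk
        exact fun k hk => improve t ⟨ht.1, ht.2.le⟩ htpos hyp k hk t ⟨ht.1, le_rfl⟩
    have hle : 𝓝[>] t ≤ 𝓝[Icc 0 σ] t := by
      rw [← nhdsWithin_Ioo_eq_nhdsGT ht.2]
      exact nhdsWithin_mono _ fun x hx => ⟨ht.1.trans hx.1.le, hx.2.le⟩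
    have hev : ∀ᶠ u in 𝓝[>] t, ∀ k ∈ Finset.Ioo Ka Kfar, ∑ i, F i k u < 5 * env k := by
      refine (eventually_all_finset _).mpr fun k hk => ?_
      rw [Finset.mem_Ioo] at hk
      have hcont : ContinuousWithinAt (fun u => ∑ i, F i k u) (Icc 0 σ) t :=
        (hsumcont k).continuousWithinAt ⟨ht.1, ht.2.le⟩
      have hlt : ∑ i, F i k t < 5 * env k := by
        have := henv_pos k
        linarith [hgood k hk.1]
      exact (hcont.tendsto.eventually (gt_mem_nhds hlt)).filter_mono hle
    filter_upwards [hev, Icc_mem_nhdsGT ht.2] with u hu hu'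
    have huI : u ∈ Icc 0 σ := ⟨ht.1.trans hu'.1, hu'.2⟩
    refine ⟨huI, fun k hk => ?_⟩
    by_cases hkf : Kfar ≤ k
    · exact hfar k hkf u huI
    · exact (hu k (Finset.mem_Ioo.mpr ⟨hk, lt_of_not_ge hkf⟩)).le
  -- conclusion
  intro k hk u hu
  have hyp : ∀ k, Ka < k → ∀ u ∈ Icc 0 σ, ∑ i, F i k u ≤ 5 * env k :=
    fun k hk u hu => (hIcc hu).2 k hk
  exact improve σ ⟨hσ.le, le_rfl⟩ hσ hyp k hk u hu

end TailEnvelopes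

end Summit.NavierStokesRegularity.NavierStokesRegularity.Theorems

end
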